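import Summits.QuantumAdvantage.QuantumAdvantage.Theorems.CubicForrelationSignedExactSliceIsLiftDefs
import Literature.Computability.Complexity.CodeFPBudgets
import Literature.Computability.Complexity.CodeFPListKit
import Literature.Computability.Complexity.CodeFPStrings
import Literature.Computability.Complexity.HiraharaMachinePre

/-!
# Stub `stub_coeffFP` of line `Sketch` (crux K2 `SignedExactSliceIsLift`, stmt-QuantumAdvantage-14830)

The typed polynomial-time certificate of the Möbius layer of the canonicaliser: from `n` in unary and a
circuit code `c` (format of `ForrelationCircuitCode.lean`, oracle `F = ForrCode.evalP c`), the monomial list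
`cubicMonomials n F = (subsets3 n).filter (mcoeff n F)` of the degree-3 truncated Möbius interpolant is
computed on codes by an `FP` string function (`CodeFP`, [cite: AroraBarak2009, §1.3]). Pure combinator
plumbing over the `CodeFP` algebra: `subsets3` is three nested context `map`s over `urange`/`rangeOf` followed
by `flatten` (the inner binary bounds `j < n` are capped by the unary `n`, `min j n = j`); `mcoeff` is the
xor-fold (finite accumulator, `foldlFin₀`) of the oracle values `evalP c (indic n T)` (`ForrCode.evalP_codeFP`
after `bitsToStr`, `indic` = `map` of `mem` over `urange`) over the sublists of `S.take 3`, which are produced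
by the capped subsets fold `HiraharaMachine.subsetsT 8` on the reversed list (`subsetsT (2^k) l.reverse =
sublists' l` for `|l| ≤ k`); finally `CodeFP.filter` with the context `(n, c)`. No mathematics beyond list
identities. [cite: Carlet2020, §2.2.1 (binary Möbius transform)]
-/

set_option linter.dupNamespace false -- D-0017: single-problem summit ⇒ `QuantumAdvantage.QuantumAdvantage` by design

noncomputable section

namespace Summit.QuantumAdvantage.QuantumAdvantage.Theorems.SignedExactSliceIsLift

open _root_.Computability Literature.Computability.Complexity Literature.Computability.Cryptography
  Literature.Computability.QuantumComplexity
open Literature.Computability.Complexity.CodeFP (strE unE natE bitE pairE rawE)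
open Summit.QuantumAdvantage.QuantumAdvantage.Theses.CubicForrelation (NearExactIsExact SignedExactSliceIsLift)

namespace StubCoeffFP

open Literature.Computability.Complexity.CodeFP ForrCode

/-! ### The weight-`≤ 3` subsets on codes -/

/-- Singletons on codes: `1ⁿ ↦ [[0], …, [n-1]]`. [cite: AroraBarak2009, §1.3] -/
theorem singles_codeFP : CodeFP unE (rawE (rawE natE)) (fun n => (List.range n).map fun i => [i]) :=
  (map₀ (rawSingleton natE)).comp urange

/-- Pairs on codes, inner bound capped by the unary `n`:
`1ⁿ ↦ ((range n).map fun j => (range (min j n)).map fun i => [i, j]).flatten`. [cite: AroraBarak2009, §1.3] -/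
theorem pairs_codeFP : CodeFP unE (rawE (rawE natE))
    (fun n => ((List.range n).map fun j => (List.range (min j n)).map fun i => [i, j]).flatten) := by
  -- item `[i, j]` in the context `(n, j)`
  have hg : CodeFP (pairE (pairE unE natE) natE) (rawE natE) (fun q => [q.2, q.1.2]) :=
    (rawCons natE).comp ((snd _ _).pair ((rawSingleton natE).comp (fst _ _).snd'))
  have hrow := (map (σ := ℕ × ℕ) (eσ := pairE unE natE) (eα := natE) (eβ := rawE natE)
    (g := fun q => [q.2, q.1.2]) hg).comp ((CodeFP.id (pairE unE natE)).pair rangeOf)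
  have hrows := (map (σ := ℕ) (eσ := unE) (eα := natE) (eβ := rawE (rawE natE))
    (g := fun p => (List.range (min p.2 p.1)).map fun i => [i, p.2]) (hrow.congr fun _ => rfl)).comp
    ((CodeFP.id unE).pair urange)
  exact ((flatten (rawE natE)).comp hrows).congr fun _ => rfl

/-- Triples on codes, inner bounds capped by the unary `n`. [cite: AroraBarak2009, §1.3] -/
theorem triples_codeFP : CodeFP unE (rawE (rawE natE))
    (fun n => ((List.range n).map fun l => ((List.range (min l n)).map fun j =>
      (List.range (min j n)).map fun i => [i, j, l]).flatten).flatten) := by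
  -- item `[i, j, l]` in the context `((n, l), j)`
  have hg : CodeFP (pairE (pairE (pairE unE natE) natE) natE) (rawE natE) (fun q => [q.2, q.1.2, q.1.1.2]) :=
    (rawCons natE).comp ((snd _ _).pair ((rawCons natE).comp ((fst _ _).snd'.pair
      ((rawSingleton natE).comp (fst _ _).fst'.snd'))))
  have hrow := (map (σ := (ℕ × ℕ) × ℕ) (eσ := pairE (pairE unE natE) natE) (eα := natE) (eβ := rawE natE)
    (g := fun q => [q.2, q.1.2, q.1.1.2]) hg).comp
    ((CodeFP.id (pairE (pairE unE natE) natE)).pair (rangeOf.comp ((fst _ _).fst'.pair (snd _ _))))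
  -- the block of `l`, context `(n, l)`
  have hblock := (flatten (rawE natE)).comp ((map (σ := ℕ × ℕ) (eσ := pairE unE natE) (eα := natE)
    (eβ := rawE (rawE natE)) (g := fun p => (List.range (min p.2 p.1.1)).map fun i => [i, p.2, p.1.2])
    (hrow.congr fun _ => rfl)).comp ((CodeFP.id (pairE unE natE)).pair rangeOf))
  have hall := (flatten (rawE natE)).comp ((map (σ := ℕ) (eσ := unE) (eα := natE) (eβ := rawE (rawE natE))
    (g := fun p => ((List.range (min p.2 p.1)).map fun j =>
      (List.range (min j p.1)).map fun i => [i, j, p.2]).flatten)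
    (hblock.congr fun _ => rfl)).comp ((CodeFP.id unE).pair urange))
  exact hall.congr fun _ => rfl

/-- **`subsets3` on codes** (`n` unary). [cite: AroraBarak2009, §1.3] -/
theorem subsets3_codeFP : CodeFP unE (rawE (rawE natE)) subsets3 := by
  have h : CodeFP unE (rawE (rawE natE)) (fun n => [[]] ++ (List.range n).map (fun i => [i]) ++
      ((List.range n).map fun j => (List.range (min j n)).map fun i => [i, j]).flatten ++
      ((List.range n).map fun l => ((List.range (min l n)).map fun j =>
        (List.range (min j n)).map fun i => [i, j, l]).flatten).flatten) :=
    ((rawAppend (rawE natE)).comp ((((rawAppend (rawE natE)).comp (((rawAppend (rawE natE)).comp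
      ((const unE ([[]] : List (List ℕ))).pair singles_codeFP)).pair pairs_codeFP))).pair
      triples_codeFP)).congr fun _ => rfl
  refine h.congr fun n => ?_
  have hj : ∀ j ∈ List.range n, min j n = j := fun j hj => min_eq_left (List.mem_range.1 hj).le
  have hB : ((List.range n).map fun j => (List.range (min j n)).map fun i => [i, j]).flatten =
      (List.range n).flatMap (fun j => (List.range j).map fun i => [i, j]) := by
    rw [List.flatMap_def]
    exact congrArg List.flatten (List.map_congr_left fun j hj' => by rw [hj j hj'])
  have hC : ((List.range n).map fun l => ((List.range (min l n)).map fun j =>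
      (List.range (min j n)).map fun i => [i, j, l]).flatten).flatten =
      (List.range n).flatMap (fun l => (List.range l).flatMap fun j => (List.range j).map fun i => [i, j, l]) := by
    rw [List.flatMap_def]
    refine congrArg List.flatten (List.map_congr_left fun l hl => ?_)
    rw [List.flatMap_def, hj l hl]
    exact congrArg List.flatten (List.map_congr_left fun j hj' => by
      rw [min_eq_left ((List.mem_range.1 hj').trans (List.mem_range.1 hl)).le])
  rw [subsets3, ← hB, ← hC]

/-! ### The Möbius coefficient on codes -/

/-- `sublists'` by the capped subsets fold on the reversed list: `subsetsT K l.reverse = sublists' l` once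
`2^{|l|} ≤ K` (the cap is then inactive). [folklore] -/
theorem subsetsT_reverse_eq (K : ℕ) : ∀ l : List ℕ, 2 ^ l.length ≤ K →
    HiraharaMachine.subsetsT K l.reverse = l.sublists'
  | [], _ => rfl
  | a :: l, h => by
    have h2 : 2 ^ (l.length + 1) ≤ K := by simpa only [List.length_cons] using h
    have hl : 2 ^ l.length ≤ K := (Nat.pow_le_pow_right (by norm_num) (Nat.le_succ _)).trans h2
    have ih := subsetsT_reverse_eq K l hl
    simp only [HiraharaMachine.subsetsT] at ih ⊢
    rw [List.reverse_cons, List.foldl_append, List.foldl_cons, List.foldl_nil, ih, ← List.sublists'_cons]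
    exact List.take_of_length_le (by rw [List.length_sublists']; exact h2)

/-- The sublists of the first three items: `S ↦ (S.take 3).sublists'`. [cite: AroraBarak2009, §1.3] -/
theorem sublists3_codeFP : CodeFP (rawE natE) (rawE (rawE natE)) (fun S => (S.take 3).sublists') := by
  have htake : CodeFP (rawE natE) (rawE natE) (fun S => S.take 3) :=
    (rawTakeUn natE).comp ((const (rawE natE) 3).pair (CodeFP.id (rawE natE)))
  refine ((HiraharaMachine.codeFP_subsetsT 8).comp ((rawReverse natE).comp htake)).congr fun S => ?_
  exact subsetsT_reverse_eq 8 (S.take 3)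
    ((Nat.pow_le_pow_right (by norm_num) (List.length_take_le 3 S)).trans (by norm_num))

/-- The indicator vector on codes: `(n, T) ↦ indic n T` (`n` unary). [cite: AroraBarak2009, §1.3] -/
theorem indic_codeFP : CodeFP (pairE unE (rawE natE)) (rawE bitE) (fun p => indic p.1 p.2) := by
  have hmem : CodeFP (pairE (rawE natE) natE) bitE (fun q => decide (q.2 ∈ q.1)) :=
    (mem natE_injective).comp ((snd _ _).pair (fst _ _))
  have hm := map (σ := List ℕ) (eσ := rawE natE) (eα := natE) (eβ := bitE) (g := fun q => decide (q.2 ∈ q.1)) hmem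
  exact (hm.comp ((snd _ _).pair (urange.comp (fst _ _)))).congr fun _ => rfl

/-- The oracle at an indicator: `((n, c), T) ↦ evalP c (indic n T)`. [cite: AroraBarak2009, §1.3] -/
theorem oracleAt_codeFP :
    CodeFP (pairE (pairE unE pcE) (rawE natE)) bitE (fun q => evalP q.1.2 (indic q.1.1 q.2)) := by
  have hx := bitsToStr.comp (indic_codeFP.comp ((fst (pairE unE pcE) (rawE natE)).fst'.pair (snd _ _)))
  exact (evalP_codeFP.comp ((fst (pairE unE pcE) (rawE natE)).snd'.pair hx)).congr fun _ => rfl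

/-- The xor-fold of a raw bit list (one-bit accumulator). [cite: AroraBarak2009, §1.3] -/
theorem xorFold_codeFP : CodeFP (rawE bitE) bitE (fun l => l.foldl (fun acc b => (acc ^^ b)) false) := by
  have hstep : CodeFP (pairE bitE bitE) bitE (fun t => (t.2 ^^ t.1)) :=
    (CodeFP.xor (snd bitE bitE) (fst bitE bitE)).congr fun _ => rfl
  exact (foldlFin₀ (step := fun b acc : Bool => (acc ^^ b)) (b₀ := false) hstep).congr fun _ => rfl

/-- **The Möbius coefficient on codes**: `((n, c), S) ↦ mcoeff n (evalP c) S`. [cite: AroraBarak2009, §1.3] -/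
theorem mcoeff_codeFP :
    CodeFP (pairE (pairE unE pcE) (rawE natE)) bitE (fun q => mcoeff q.1.1 (evalP q.1.2) q.2) := by
  have hm := map (σ := ℕ × PCirc) (eσ := pairE unE pcE) (eα := rawE natE) (eβ := bitE)
    (g := fun q => evalP q.1.2 (indic q.1.1 q.2)) oracleAt_codeFP
  have h := xorFold_codeFP.comp (hm.comp ((fst (pairE unE pcE) (rawE natE)).pair
    (sublists3_codeFP.comp (snd _ _))))
  exact h.congr fun _ => rfl

end StubCoeffFP

/-- **Stub `stub_coeffFP`**: the monomial list of the degree-3 truncated Möbius interpolant of the oracle of a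
circuit code, `(1ⁿ, c) ↦ cubicMonomials n (evalP c)`, is computed on codes in polynomial time.
[cite: AroraBarak2009, §1.3; Carlet2020, §2.2.1] -/
theorem stub_coeffFP :
    CodeFP (pairE unE ForrCode.pcE) (rawE (rawE natE)) (fun p => cubicMonomials p.1 (ForrCode.evalP p.2)) := by
  have hf := CodeFP.filter (σ := ℕ × ForrCode.PCirc) (eσ := pairE unE ForrCode.pcE) (eα := rawE natE)
    (p := fun q => mcoeff q.1.1 (ForrCode.evalP q.1.2) q.2) StubCoeffFP.mcoeff_codeFP
  exact (hf.comp ((CodeFP.id _).pair (StubCoeffFP.subsets3_codeFP.comp (CodeFP.fst _ _)))).congr fun _ => rfl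

end Summit.QuantumAdvantage.QuantumAdvantage.Theorems.SignedExactSliceIsLift

end
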